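import Summits.BirchSwinnertonDyer.Rank1Residual.P2.CongruentNumberEvenAokiMonskyShape
import HarnessLib

/-!
# Cell `bsd-monsky`: AOKI = MONSKY, THE ODD CLASSES — part 3, the dictionary (i): Aoki's symbols on an ODD
# `n = p₁⋯p_k` and Monsky's ODD matrix in the shape `( Lᵀ + D_t  D_t ; D_t  Lᵀ + D_t + D_ε )`, `L = Aᵀ`
# (nothing arithmetic asserted)

HONEST FRAMING (cell `bsd-monsky`, run/shared/lean/pub/bsd-monsky/, README §1). This file asserts NO arithmetic
fact and carries NO named-fact binder: it EVALUATES Aoki's symbols `λ_{p_j}(x) = {−n, x}_{p_j}` (Aoki 1999 §2) on an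
odd square-free `n = p₁⋯p_k` (`p : Fin k → ℕ` injective, odd primes) — `λ_{p_j}(p_i) = [(p_i/p_j) = −1] = A_ji`
(`i ≠ j`), `λ_{p_j}(p_j) = Σ_{i≠j}[(p_i/p_j) = −1] = A_jj`, i.e. `λ_{p_j}(p_i) = (Aᵀ)_ij` with `A` Monsky's matrix
— and puts Monsky's ODD matrix `( A + D₂  D₂ ; D₂  A + D₋₂ )` (appendix to Heath-Brown 1994, p. 39) in the shape
of the odd kernel count (`…OddAokiMonskyKernel.lean`): `D₋₂ = D₂ + D₋₁` (the bits of `(−2/p) = (−1/p)(2/p)` add),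
`L := Aᵀ` satisfies `Lᵀ = L + εεᵀ + D_ε` (quadratic reciprocity) and has zero column sums, `Σ ε = 1` when
`n ≡ 3 (mod 4)`, and `Σ t = [n ≡ 3 (mod 8)]` on the classes `n ≡ 3, 7 (mod 8)` (through `χ₈`). The assembly of
the odd theorem is OWED (HOME/proof/PROOF-B-AOKI-MONSKY.md §5).

References: [Aoki1999] §2 pp. 79–81; [HeathBrown1994SelmerCongruentII] Appendix (Monsky), typescript p. 39 L10–L33;
[Serre1973] Ch. III §1.2 Thms. 1–2; [IrelandRosen1990] Ch. 5 §§1–2.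
-/

noncomputable section

open scoped Classical

open Matrix WeierstrassCurve Literature.NumberTheory.EllipticCurves
  Literature.NumberTheory.EllipticCurves.Aoki1999
  Literature.NumberTheory.EllipticCurves.HeathBrown1994
  Literature.NumberTheory.EllipticCurves.HeathBrown1994.Families
  Literature.NumberTheory.QuadraticForms

set_option autoImplicit false

namespace Summit.BirchSwinnertonDyer.Rank1Residual.P2.AokiMonsky

/-! ## §1 Aoki's symbols on an odd `n = p₁⋯p_k` -/

section OddSymbols

variable {k : ℕ} (p : Fin k → ℕ) (hp : ∀ i, (p i).Prime) (hodd : ∀ i, Odd (p i))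
  (hinj : Function.Injective p)

/-- `−n = p_j · m_j`, `m_j = −∏_{i ≠ j} pᵢ`, for `n = p₁⋯p_k`. [folklore] -/
theorem neg_cast_prod_eq (j : Fin k) :
    -((∏ i, p i : ℕ) : ℤ) = (p j : ℤ) * (-(∏ i ∈ Finset.univ.erase j, (p i : ℤ))) := by
  push_cast
  rw [prod_cast_eq_mul_prod_erase p j]
  ring

include hp in
/-- `−n ≠ 0`. [folklore] -/
theorem neg_cast_prod_ne_zero : -((∏ i, p i : ℕ) : ℤ) ≠ 0 :=
  neg_ne_zero.mpr (by exact_mod_cast Finset.prod_ne_zero_iff.mpr fun i _ => (hp i).ne_zero)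

include hp in
/-- `m_j ≠ 0`. [folklore] -/
theorem odd_cofactor_ne_zero (j : Fin k) : -(∏ i ∈ Finset.univ.erase j, (p i : ℤ)) ≠ 0 :=
  neg_ne_zero.mpr (Finset.prod_ne_zero_iff.mpr fun i _ => by exact_mod_cast (hp i).ne_zero)

include hp hinj in
/-- `p_j ∤ m_j` (distinct primes). [folklore] -/
theorem not_dvd_odd_cofactor (j : Fin k) : ¬ (p j : ℤ) ∣ -(∏ i ∈ Finset.univ.erase j, (p i : ℤ)) := by
  intro h
  rw [dvd_neg] at h
  have hpr : Prime (p j : ℤ) := Nat.prime_iff_prime_int.mp (hp j)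
  obtain ⟨i, hi, hdi⟩ := (Prime.dvd_finsetProd_iff hpr _).mp h
  have hij : p j = p i := (Nat.prime_dvd_prime_iff_eq (hp j) (hp i)).mp (by exact_mod_cast hdi)
  exact (Finset.mem_erase.mp hi).1 (hinj hij).symm

include hp hodd hinj in
/-- **`λ_{p_j}(p_i) = [(p_i/p_j) = −1]` for `i ≠ j`, odd `n`.** [cite: Aoki1999, §2 p. 79] [cite: Serre1973, Ch. III §1.2 Thm. 1] -/
theorem lam_odd_prime_prime_of_ne {i j : Fin k} (hij : i ≠ j) :
    lam (∏ i, p i) (p j) (p i) = addLegendreSym (p i) (p j) := by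
  haveI : Fact (p j).Prime := ⟨hp j⟩
  have h2 : p j ≠ 2 := prime_ne_two p hodd j
  rw [lam_of_ne_two (hp j) h2]
  refine hilbertBit_eq_addLegendreSym (neg_cast_prod_ne_zero p hp) (by exact_mod_cast (hp i).ne_zero) ?_
  rw [neg_cast_prod_eq p j,
    localSign_mul_left (p j) (by exact_mod_cast (hp j).ne_zero) (odd_cofactor_ne_zero p hp j)
      (by exact_mod_cast (hp i).ne_zero),
    localSign_comm (p j) (p j), localSign_odd_unit_prime h2 (not_dvd_prime_of_ne p hp hinj hij),
    localSign_odd_unit_unit h2 (not_dvd_odd_cofactor p hp hinj j) (not_dvd_prime_of_ne p hp hinj hij),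
    mul_one, jacobiSym.legendreSym.to_jacobiSym]

include hp hodd hinj in
/-- **`λ_{p_j}(p_j) = Σ_{i ≠ j} [(p_i/p_j) = −1]` for odd `n`** (the bit of `((n/p_j)/p_j) = ∏_{i≠j}(p_i/p_j)`):
`{−n, p_j} = {p_j, −1} + Σ_i {p_j, p_i}`, the two bits `{p_j, −1} = {p_j, p_j} = ε_j` cancelling.
[cite: Aoki1999, §2 p. 79] [cite: Serre1973, Ch. III §1.2 Thms. 1–2] -/
theorem lam_odd_prime_self (j : Fin k) :
    lam (∏ i, p i) (p j) (p j) = ∑ i ∈ Finset.univ.erase j, addLegendreSym (p i) (p j) := by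
  haveI : Fact (p j).Prime := ⟨hp j⟩
  have h2 : p j ≠ 2 := prime_ne_two p hodd j
  have hpj0 : (p j : ℤ) ≠ 0 := by exact_mod_cast (hp j).ne_zero
  have hP0 : ∀ i ∈ (Finset.univ : Finset (Fin k)), (p i : ℤ) ≠ 0 := fun i _ => by
    exact_mod_cast (hp i).ne_zero
  have hodd' : Odd (p j) := hodd j
  have hn1 : ¬ (p j : ℤ) ∣ -1 := by
    rw [dvd_neg, Int.natCast_dvd_ofNat]
    exact fun h => (hp j).one_lt.ne' (Nat.dvd_one.mp h)
  rw [lam_of_ne_two (hp j) h2, hilbertBit_comm (neg_cast_prod_ne_zero p hp) hpj0,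
    show -((∏ i, p i : ℕ) : ℤ) = (-1) * ∏ i, (p i : ℤ) by push_cast; ring,
    hilbertBit_mul_right hpj0 (by norm_num) (Finset.prod_ne_zero_iff.mpr hP0),
    hilbertBit_finset_prod_right hpj0 _ _ hP0, ← Finset.add_sum_erase _ _ (Finset.mem_univ j)]
  have e1 : hilbertBit (p j) (p j) (-1) = addLegendreSym (-1) (p j) := by
    refine hilbertBit_eq_addLegendreSym hpj0 (by norm_num) ?_
    rw [localSign_comm, localSign_odd_unit_prime h2 hn1, jacobiSym.legendreSym.to_jacobiSym]
  have e3 : hilbertBit (p j) (p j) (p j) = addLegendreSym (-1) (p j) := by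
    refine hilbertBit_eq_addLegendreSym hpj0 hpj0 ?_
    unfold localSign
    rw [if_neg h2, localSignOdd_self_self, jacobiSym.at_neg_one hodd']
  have e4 : ∀ i ∈ Finset.univ.erase j, hilbertBit (p j) (p j) (p i) = addLegendreSym (p i) (p j) := by
    intro i hi
    have hij : i ≠ j := (Finset.mem_erase.mp hi).1
    refine hilbertBit_eq_addLegendreSym hpj0 (by exact_mod_cast (hp i).ne_zero) ?_
    rw [localSign_comm, localSign_odd_unit_prime h2 (not_dvd_prime_of_ne p hp hinj hij),
      jacobiSym.legendreSym.to_jacobiSym]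
  rw [e1, e3, Finset.sum_congr rfl e4]
  have : ∀ x z : ZMod 2, x + (x + z) = z := by decide
  exact this _ _

include hp hodd hinj in
/-- **Aoki's `λ_{p_j}(p_i)` on an odd `n` is the `(i, j)` entry of `L = Aᵀ`** (all `i, j`).
[cite: Aoki1999, §2 p. 79] [cite: HeathBrown1994SelmerCongruentII, Appendix (Monsky), typescript p. 39 L13–L26] -/
theorem lam_odd_eq_transpose_legendreMatrix (i j : Fin k) :
    lam (∏ i, p i) (p j) (p i) = (legendreMatrix p)ᵀ i j := by
  rw [Matrix.transpose_apply]
  simp only [legendreMatrix, Matrix.of_apply]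
  by_cases h : i = j
  · subst h
    rw [if_pos rfl, lam_odd_prime_self p hp hodd hinj i]
  · rw [if_neg (Ne.symm h), lam_odd_prime_prime_of_ne p hp hodd hinj h]

end OddSymbols

/-! ## §2 Monsky's ODD matrix in the shape `( Lᵀ + D_t  D_t ; D_t  Lᵀ + D_t + D_ε )`, `L = Aᵀ` -/

section OddShape

variable {k : ℕ} (p : Fin k → ℕ) (hp : ∀ i, (p i).Prime) (hodd : ∀ i, Odd (p i))
  (hinj : Function.Injective p)

include hp hodd in
/-- **`[(−2/p_i) = −1] = [(2/p_i) = −1] + [(−1/p_i) = −1]`**: `D₋₂ = D₂ + D₋₁` over `𝔽₂`.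
[cite: IrelandRosen1990, Ch. 5 §1] -/
theorem addLegendreSym_neg_two (i : Fin k) :
    addLegendreSym (-2) (p i) = addLegendreSym 2 (p i) + addLegendreSym (-1) (p i) := by
  have h2 : jacobiSym 2 (p i) = 1 ∨ jacobiSym 2 (p i) = -1 := by
    apply jacobiSym.eq_one_or_neg_one
    have hc : Nat.Coprime 2 (p i) :=
      (Nat.coprime_primes Nat.prime_two (hp i)).mpr (prime_ne_two p hodd i).symm
    rw [show (2 : ℤ) = ((2 : ℕ) : ℤ) from rfl, Int.gcd_natCast_natCast]
    exact hc
  have h1 : jacobiSym (-1) (p i) = 1 ∨ jacobiSym (-1) (p i) = -1 := by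
    rw [jacobiSym_neg_one_eq_ite p hodd i]
    split_ifs <;> simp
  rw [addLegendreSym_def, addLegendreSym_def, addLegendreSym_def,
    show (-2 : ℤ) = 2 * (-1) by norm_num, jacobiSym.mul_left]
  exact ite_mul_sign_eq_add h2 h1

include hp hodd in
/-- `D₋₂ = D_t + D_ε` as diagonal matrices. [cite: HeathBrown1994SelmerCongruentII, Appendix (Monsky), typescript p. 39 L10–L13] -/
theorem legendreDiagonal_neg_two :
    legendreDiagonal p (-2) =
      (Matrix.diagonal fun i => addLegendreSym 2 (p i)) + Matrix.diagonal fun i => addLegendreSym (-1) (p i) := by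
  rw [Matrix.diagonal_add]
  unfold legendreDiagonal
  congr 1
  funext i
  exact addLegendreSym_neg_two p hp hodd i

include hp hodd in
/-- `M_odd = ( A + D₂  D₂ ; D₂  A + D₋₂ ) = ( Lᵀ + D_t  D_t ; D_t  Lᵀ + D_t + D_ε )` with `L = Aᵀ`.
[cite: HeathBrown1994SelmerCongruentII, Appendix (Monsky), typescript p. 39 L27–L33] -/
theorem monskyMatrixOdd_eq_fromBlocks :
    monskyMatrixOdd p =
      Matrix.fromBlocks ((legendreMatrix p)ᵀᵀ + Matrix.diagonal fun i => addLegendreSym 2 (p i))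
        (Matrix.diagonal fun i => addLegendreSym 2 (p i))
        (Matrix.diagonal fun i => addLegendreSym 2 (p i))
        ((legendreMatrix p)ᵀᵀ + (Matrix.diagonal fun i => addLegendreSym 2 (p i)) +
          Matrix.diagonal fun i => addLegendreSym (-1) (p i)) := by
  rw [Matrix.transpose_transpose]
  unfold monskyMatrixOdd
  rw [legendreDiagonal_neg_two p hp hodd, ← add_assoc]
  rfl

/-- **`s_odd(n) = dim ker M_odd`** (rank–nullity). [cite: HeathBrown1994SelmerCongruentII, Appendix (Monsky), typescript p. 39 L33] -/
theorem monskySelmerRankOdd_eq_finrank_ker :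
    monskySelmerRankOdd p =
      Module.finrank (ZMod 2) ↥(LinearMap.ker (monskyMatrixOdd p).mulVecLin) := by
  have h := LinearMap.finrank_range_add_finrank_ker (monskyMatrixOdd p).mulVecLin
  rw [Module.finrank_pi (ZMod 2), Fintype.card_sum, Fintype.card_fin] at h
  rw [monskySelmerRankOdd, Matrix.rank]
  omega

include hp hodd hinj in
/-- **`Lᵀ = L + εεᵀ + D_ε` for `L = Aᵀ`** (quadratic reciprocity, entrywise). [cite: IrelandRosen1990, Ch. 5 §2 Thm. 1] -/
theorem transposeA_hLT (i j : Fin k) :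
    (legendreMatrix p)ᵀ j i =
      (legendreMatrix p)ᵀ i j + addLegendreSym (-1) (p i) * addLegendreSym (-1) (p j) +
        if i = j then addLegendreSym (-1) (p i) else 0 := by
  simp only [Matrix.transpose_apply, legendreMatrix, Matrix.of_apply]
  by_cases h : i = j
  · subst h
    simp only [if_true]
    have : ∀ x e : ZMod 2, x = x + e * e + e := by decide
    exact this _ _
  · rw [if_neg h, if_neg (Ne.symm h), if_neg h, add_zero, addLegendreSym_swap p hp hodd hinj h]

/-- **Zero column sums of `L = Aᵀ`** (zero row sums of `A`). [cite: HeathBrown1994SelmerCongruentII, Appendix (Monsky), typescript p. 39 L13–L26] -/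
theorem transposeA_sum_col (i : Fin k) : ∑ j, (legendreMatrix p)ᵀ j i = 0 := by
  simp only [Matrix.transpose_apply]
  rw [← Finset.add_sum_erase _ _ (Finset.mem_univ i)]
  simp only [legendreMatrix, Matrix.of_apply, if_true]
  rw [Finset.sum_congr rfl fun j hj => if_neg (Ne.symm (Finset.mem_erase.mp hj).1)]
  exact CharTwo.add_self_eq_zero _

include hodd in
/-- **`Σ ε_i = 1` when `p₁⋯p_k ≡ 3 (mod 4)`** (through `χ₄`). [cite: IrelandRosen1990, Ch. 5 §1] -/
theorem sum_eps_eq_one_of_prod_mod_four (hP : (∏ i, p i) % 4 = 3) : ∑ i, addLegendreSym (-1) (p i) = 1 := by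
  have hχ : ZMod.χ₄ ((∏ i, p i : ℕ) : ZMod 4) = -1 := ZMod.χ₄_nat_three_mod_four hP
  rw [Nat.cast_prod, map_prod] at hχ
  have hsigns : ∀ i ∈ (Finset.univ : Finset (Fin k)),
      ZMod.χ₄ ((p i : ℕ) : ZMod 4) = 1 ∨ ZMod.χ₄ ((p i : ℕ) : ZMod 4) = -1 := by
    intro i _
    rw [ZMod.χ₄_nat_eq_if_mod_four, if_neg (by have := Nat.odd_iff.mp (hodd i); omega)]
    split_ifs <;> simp
  rw [prod_sign_eq_ite_sum_bits _ _ hsigns] at hχ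
  have hne : (∑ i, if ZMod.χ₄ ((p i : ℕ) : ZMod 4) = 1 then (0 : ZMod 2) else 1) ≠ 0 := by
    intro h0; rw [if_pos h0] at hχ; exact absurd hχ (by decide)
  have h01 : ∀ x : ZMod 2, x = 0 ∨ x = 1 := by decide
  have heq : (∑ i, if ZMod.χ₄ ((p i : ℕ) : ZMod 4) = 1 then (0 : ZMod 2) else 1) =
      ∑ i, addLegendreSym (-1) (p i) :=
    Finset.sum_congr rfl fun i _ => by rw [addLegendreSym_def, jacobiSym.at_neg_one (hodd i)]
  rw [heq] at hne
  exact (h01 _).resolve_left hne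

include hodd in
/-- The bits of `(2/p_i)` through `χ₈`: `∏ χ₈(p_i)` is `1` or `−1` according as `Σ t_i` is `0` or `1`.
[cite: IrelandRosen1990, Ch. 5 §1] -/
theorem prod_chi8_eq_ite_sum_t :
    ∏ i, ZMod.χ₈ ((p i : ℕ) : ZMod 8) = if (∑ i, addLegendreSym 2 (p i)) = 0 then 1 else -1 := by
  have hsigns : ∀ i ∈ (Finset.univ : Finset (Fin k)),
      ZMod.χ₈ ((p i : ℕ) : ZMod 8) = 1 ∨ ZMod.χ₈ ((p i : ℕ) : ZMod 8) = -1 := by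
    intro i _
    rw [ZMod.χ₈_nat_eq_if_mod_eight, if_neg (by have := Nat.odd_iff.mp (hodd i); omega)]
    split_ifs <;> simp
  rw [prod_sign_eq_ite_sum_bits _ _ hsigns]
  have heq : (∑ i, if ZMod.χ₈ ((p i : ℕ) : ZMod 8) = 1 then (0 : ZMod 2) else 1) =
      ∑ i, addLegendreSym 2 (p i) :=
    Finset.sum_congr rfl fun i _ => by rw [addLegendreSym_def, jacobiSym.at_two (hodd i)]
  rw [heq]

include hodd in
/-- **`Σ t_i = 1` for `p₁⋯p_k ≡ 3 (mod 8)`** (an odd number of `p_i ≡ ±3 (mod 8)`). [cite: IrelandRosen1990, Ch. 5 §1] -/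
theorem sum_t_eq_one_of_prod_mod_eight_three (hP : (∏ i, p i) % 8 = 3) :
    ∑ i, addLegendreSym 2 (p i) = 1 := by
  have hχ : ZMod.χ₈ ((∏ i, p i : ℕ) : ZMod 8) = -1 := by
    rw [ZMod.χ₈_nat_eq_if_mod_eight, if_neg (by omega), if_neg (by omega)]
  rw [Nat.cast_prod, map_prod, prod_chi8_eq_ite_sum_t p hodd] at hχ
  have h01 : ∀ x : ZMod 2, x = 0 ∨ x = 1 := by decide
  rcases h01 (∑ i, addLegendreSym 2 (p i)) with h | h
  · rw [h, if_pos rfl] at hχ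
    exact absurd hχ (by decide)
  · exact h

include hodd in
/-- **`Σ t_i = 0` for `p₁⋯p_k ≡ 7 (mod 8)`** (an even number of `p_i ≡ ±3 (mod 8)`). [cite: IrelandRosen1990, Ch. 5 §1] -/
theorem sum_t_eq_zero_of_prod_mod_eight_seven (hP : (∏ i, p i) % 8 = 7) :
    ∑ i, addLegendreSym 2 (p i) = 0 := by
  have hχ : ZMod.χ₈ ((∏ i, p i : ℕ) : ZMod 8) = 1 := by
    rw [ZMod.χ₈_nat_eq_if_mod_eight, if_neg (by omega), if_pos (Or.inr hP)]
  rw [Nat.cast_prod, map_prod, prod_chi8_eq_ite_sum_t p hodd] at hχ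
  have h01 : ∀ x : ZMod 2, x = 0 ∨ x = 1 := by decide
  rcases h01 (∑ i, addLegendreSym 2 (p i)) with h | h
  · exact h
  · rw [h, if_neg (by decide)] at hχ
    exact absurd hχ (by decide)

end OddShape

end Summit.BirchSwinnertonDyer.Rank1Residual.P2.AokiMonsky

end
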